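import Literature.NumberTheory.EllipticCurves.TwoAdicImageModEightArithmeticProofs
import Mathlib.NumberTheory.Real.Irrational
import HarnessLib

/-!
# Dokchitser–Dokchitser 2012, Theorem, clause (3) — PROVED:
# `ρ̄_{E,8}` is onto `Aut(E[8])` iff `ρ̄_{E,4}` is onto and `Δ ∉ ±2·ℚ^{×2}`

`Proofs` companion (theorems only; no named fact, no instance; D-0014/D-0026) of
`TwoAdicImageSurjectivity`, whose named fact `DokchitserDokchitser2012_surjective_mod_two_four_eight`
records T. Dokchitser, V. Dokchitser, *Surjectivity of mod `2ⁿ` representations of elliptic curves*,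
Math. Z. 272 (2012) 961–964, Theorem, as the conjunction of three clauses. Clause (1) is the tree
theorem `hasSurjectiveModNGaloisRep_two_iff` (`TwoAdicImageSurjectivityModTwoProofs`); this file
proves **clause (3)** in the kernel, byte-for-byte as stated there:

* `hasSurjectiveModNGaloisRep_eight_iff` — for an elliptic curve `W/ℚ` (any model),
  `W.HasSurjectiveModNGaloisRep 8 ↔ W.HasSurjectiveModNGaloisRep 4 ∧ ¬ IsSquare (2 * W.Δ) ∧ ¬ IsSquare (-2 * W.Δ)`,

and hence the named fact REDUCED TO CLAUSE (2) ALONE (`…_of_clause_two`).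

THE PRINTED PROOF, FOLLOWED ([corpus:paper:arxiv-1104.5031 p0001 L58–L98]): "by the properties of
the Weil pairing, `ℚ(E[n]) ⊃ ℚ(ζₙ)` and `Gal(ℚ(E[n])/ℚ) ↠ (ℤ/nℤ)^×` is simply the determinant. In
particular `ℚ(E[8]) ⊃ ℚ(√Δ, √-1, √2)` … (3) If `ρ̄₈` is surjective, then so is `ρ̄₄`, and as
`ℚ(√Δ) ≠ ℚ(√±2)`, it follows that `Δ ∉ ±2·ℚ^{×2}`. Conversely, if `ρ̄₄` is surjective and
`Δ ∉ ±2·ℚ^{×2}`, then … `Im ρ̄₈` surjects onto `GL₂(ℤ/4ℤ)` and onto `(ℤ/8ℤ)^×`, and possesses a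
`C₂ × C₂ × C₂`-quotient. A computation shows that the only such subgroup of `GL₂(ℤ/8ℤ)` is the full
group itself."  Made explicit: the computation is `GL2Mod8.surjective_of_liftsModFour`
(`GL2ModEightFullImageProofs`); `ρ̄₈` as matrices `rhoMat` in a frame `E[8] ≅ (ℤ/8)²`, "onto" ⟺ every
invertible matrix realised, `ρ̄₄` onto ⟹ realised modulo `4` (`TorsionGaloisRepMatrixProofs`) and
(§1 here) `ρ̄₈` onto ⟹ `ρ̄₄` onto (automorphisms of `E[4]` lift to `E[8]`); `ζ₈ = e₈(P₀,Q₀)`,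
`σζ₈ = ζ₈^{det}`, `√2 = ζ₈ + ζ₈⁷`, `√-2 = ζ₈ + ζ₈³`, `σ√±2 = χ_{±2}(det)·√±2`, `σδ = sgn(ρ̄₈σ mod 2)·δ`
with `Δ = 16δ²` (`TwoAdicImageModEightArithmeticProofs`); (§2 here) over a perfect field `K` with
`2 ≠ 0`, non-squares `2, -2, 2Δ = 2(4δ)², -2Δ` give `σ`'s moving `√2, √-2, √2δ, √-2δ`
(`K̄^{Γ_K} = K`) — the "`C₂³`-quotient" — and conversely `diag(1,3), diag(1,5) ∈ Im ρ̄₈` move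
`√2δ`, `√-2δ` ("`ℚ(√Δ) ≠ ℚ(√±2)`"); (§3) assembly over `K` (hypotheses `±2 ∉ K^{×2}`, automatic for
`ℚ`) and over `ℚ`.

## References

* [DokchitserDokchitserMathZ2012] T. Dokchitser, V. Dokchitser, Math. Z. 272 (2012) 961–964,
  Theorem (3) and its proof. [corpus:paper:arxiv-1104.5031 p0001 L32–L48, L58–L98]
* [SilvermanAEC2009] J. H. Silverman, *The Arithmetic of Elliptic Curves*, 2nd ed., GTM 106
  (2009), III.6.4(b), III.7, III.8, VIII.1.
-/

set_option autoImplicit false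

noncomputable section

open scoped Classical

open Matrix WeierstrassCurve

namespace Literature.NumberTheory.EllipticCurves.DokchitserDokchitser2012

open Literature.NumberTheory.GaloisRepresentations.GL2Mod8

universe u

variable {K : Type u} [Field K] (W : WeierstrassCurve K)

/-! ### §1. `ρ̄₈` onto ⟹ `ρ̄₄` onto: automorphisms of `E[4]` lift to `E[8]` -/

section Lift

variable (e : geomTorsion W 8 ≃+ (Fin 2 → ZMod 8))

/-- **`ρ̄₈` onto ⟹ `ρ̄₄` onto** (every automorphism of `E[4]` is the restriction of one of `E[8]`):
if every invertible matrix over `ℤ/8` is some `rhoMat σ`, then `ρ̄₄` is onto.  For `β ∈ Aut(E[4])`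
write `e (β (2e⁻¹δ_j)) = 2 g_j`; the matrix `g = (g₀ | g₁)` is invertible because `β` is injective
(a column `v` of `adj g` reduced modulo `2` would give `β (4 e⁻¹ v) = e⁻¹ (4 det g · δ_j) = 0`), and
`σ` with `rhoMat σ = g` restricts to `β`. [cite: DokchitserDokchitserMathZ2012, proof of Theorem (3) ("if ρ̄₈ is surjective, then so is ρ̄₄")] -/
theorem hasSurjectiveModNGaloisRep_four_of_matrix
    (h : ∀ g : M8, g.det * g.det = 1 → ∃ σ : Field.absoluteGaloisGroup K, rhoMat W e σ = g) :
    W.HasSurjectiveModNGaloisRep 4 := by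
  intro β'
  set β : geomTorsion W 4 ≃+ geomTorsion W 4 := β'.toAdd with hβ
  -- the basis `Q_j = 2 e⁻¹ δ_j` of `E[4]` and the columns `g_j`
  have hQ : ∀ c : Fin 2 → ZMod 8, ((e.symm (2 • c) : geomTorsion W 8) : geomPoints W) ∈ geomTorsion W 4 :=
    fun c ↦ (mem_four_iff W _).mpr (four_nsmul_symm_two_nsmul W e c)
  -- `β` on `e⁻¹(2c)`, as an element of `E[8]`
  set B : (Fin 2 → ZMod 8) → geomTorsion W 8 := fun c ↦
    ⟨(β ⟨_, hQ c⟩ : geomPoints W), mem_geomTorsion_eight_of_four W (β ⟨_, hQ c⟩).2⟩ with hB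
  have hBadd : ∀ c c', B (c + c') = B c + B c' := by
    intro c c'
    apply Subtype.ext
    change ((β _ : geomTorsion W 4) : geomPoints W) = (β _ : geomPoints W) + (β _ : geomPoints W)
    rw [← AddSubgroup.coe_add, ← map_add]
    congr 2
    apply Subtype.ext
    change ((e.symm (2 • (c + c')) : geomTorsion W 8) : geomPoints W) = _
    rw [smul_add, map_add]
    rfl
  have hB4 : ∀ c, 4 • B c = 0 := by
    intro c
    rw [← mem_four_iff]
    exact (β ⟨_, hQ c⟩).2
  -- coordinates: `e (B δ_j) = 2 • g_j`
  choose col hcol using fun j : Fin 2 ↦ exists_eq_symm_two_nsmul W e (hB4 (Pi.single j 1))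
  set g : M8 := Matrix.of fun i j ↦ col j i with hg
  have hBe : ∀ c : Fin 2 → ZMod 8, e (B c) = 2 • (g *ᵥ c) := by
    intro c
    have hc : c = (c 0).val • Pi.single 0 1 + (c 1).val • Pi.single 1 1 := by
      ext i; simp only [Pi.add_apply, Pi.smul_apply, Pi.single_apply]; fin_cases i <;> simp
    have hBn : ∀ (n : ℕ) (c : Fin 2 → ZMod 8), B (n • c) = n • B c := by
      intro n c
      induction n with
      | zero =>
        simp only [zero_smul]
        apply Subtype.ext
        change ((β _ : geomTorsion W 4) : geomPoints W) = 0
        rw [show (⟨((e.symm (2 • (0 : Fin 2 → ZMod 8)) : geomTorsion W 8) : geomPoints W), hQ 0⟩ :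
          geomTorsion W 4) = 0 from Subtype.ext (by simp), map_zero]
        rfl
      | succ n ih => rw [succ_nsmul, hBadd, ih, succ_nsmul]
    conv_lhs => rw [hc]
    rw [hBadd, hBn, hBn, map_add, map_nsmul, map_nsmul, hcol 0, hcol 1, e.apply_symm_apply,
      e.apply_symm_apply]
    ext i
    simp only [Pi.add_apply, Pi.smul_apply]
    simp [hg, Matrix.mulVec, dotProduct, Fin.sum_univ_two, nsmul_eq_mul]
    ring
  -- `det g` is odd: otherwise `β` kills a nonzero `2`-torsion point
  have hdet : g.det * g.det = 1 := by
    rw [GaloisRepresentations.GL2Mod8.mul_self_eq_one_iff]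
    by_contra hev
    have hev' : red g.det = 0 := by
      rcases (by decide : ∀ z : ZMod 2, z = 0 ∨ z = 1) (red g.det) with h0 | h1
      · exact h0
      · exact absurd h1 hev
    -- a vector `v` with `4 • (g v) = 0` but `4 • v ≠ 0`
    have key : ∀ v : Fin 2 → ZMod 8, 4 • (g *ᵥ v) = 0 → 4 • v = 0 := by
      intro v hv
      have h1 : e (B (2 • v)) = 0 := by
        rw [hBe, Matrix.mulVec_smul, smul_smul]; exact hv
      have h2 : B (2 • v) = 0 := e.map_eq_zero_iff.mp h1
      have h3 : (⟨_, hQ (2 • v)⟩ : geomTorsion W 4) = 0 := by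
        apply β.injective
        rw [map_zero]
        apply Subtype.ext
        have h2' : ((B (2 • v) : geomTorsion W 8) : geomPoints W) = 0 := congrArg Subtype.val h2
        exact h2'
      have h3' : ((e.symm (2 • (2 • v)) : geomTorsion W 8) : geomPoints W) = 0 :=
        congrArg Subtype.val h3
      have h4 : (e.symm (2 • (2 • v)) : geomTorsion W 8) = 0 := Subtype.ext h3'
      rw [e.symm.map_eq_zero_iff, smul_smul] at h4
      exact h4
    -- the columns of `adj g` reduce `g` to `det g`: `g (adj g δ_j) = det g • δ_j`
    have hadj : ∀ j, 4 • (g *ᵥ (g.adjugate *ᵥ Pi.single j 1)) = 0 := by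
      intro j
      rw [Matrix.mulVec_mulVec, Matrix.mul_adjugate, Matrix.smul_mulVec, Matrix.one_mulVec]
      ext i
      simp only [Pi.smul_apply, Pi.zero_apply, Pi.single_apply, smul_eq_mul, nsmul_eq_mul,
        Nat.cast_ofNat]
      split_ifs
      · rw [mul_one, four_mul_eq_zero_of_red hev']
      · rw [mul_zero, mul_zero]
    have hcols : ∀ j i, 4 * g.adjugate i j = 0 := by
      intro j i
      have := congr_fun (key _ (hadj j)) i
      simpa [Matrix.mulVec, dotProduct, Pi.single_apply, Fin.sum_univ_two, nsmul_eq_mul] using this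
    -- so all entries of `g` are even, and then `β (4 e⁻¹ δ₀) = 0` with `4 e⁻¹ δ₀ ≠ 0`
    have hg00 : 4 * g 0 0 = 0 := by simpa [Matrix.adjugate_fin_two] using hcols 1 1
    have hg10 : 4 * g 1 0 = 0 := by
      have := hcols 0 1; simp [Matrix.adjugate_fin_two] at this; simpa using this
    have h5 : 4 • (Pi.single 0 1 : Fin 2 → ZMod 8) = 0 := by
      apply key
      ext i
      fin_cases i <;> simp [nsmul_eq_mul, hg00, hg10]
    have h6 := congr_fun h5 0
    simp [nsmul_eq_mul] at h6
    exact absurd h6 (by decide)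
  -- the lift
  obtain ⟨σ, hσ⟩ := h g hdet
  refine ⟨σ, Multiplicative.toAdd.injective (AddEquiv.ext fun P ↦ ?_)⟩
  rw [← hβ]
  apply Subtype.ext
  rw [galoisRepTorsion_apply, AddSubgroup.torsionBy.coe_smul]
  -- `P = e⁻¹(2c)` inside `E[8]`
  set P8 : geomTorsion W 8 := ⟨P, mem_geomTorsion_eight_of_four W P.2⟩ with hP8
  have hP4 : 4 • P8 = 0 := (mem_four_iff W P8).mp P.2
  obtain ⟨c, hc⟩ := exists_eq_symm_two_nsmul W e hP4
  have hPe : P = ⟨_, hQ c⟩ := Subtype.ext (by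
    change (P8 : geomPoints W) = ((e.symm (2 • c) : geomTorsion W 8) : geomPoints W)
    exact congrArg Subtype.val hc)
  have hσP : e (σ • P8) = e (B c) := by
    rw [rhoMat_mulVec, hσ, hc, e.apply_symm_apply, hBe, Matrix.mulVec_smul]
  have hσP' : σ • P8 = B c := e.injective hσP
  have := congrArg Subtype.val hσP'
  rw [AddSubgroup.torsionBy.coe_smul] at this
  rw [this, hB, hPe]

include e in
/-- **`ρ̄_{E,8}` onto ⟹ `ρ̄_{E,4}` onto** ("If `ρ̄₈` is surjective, then so is `ρ̄₄`").
[cite: DokchitserDokchitserMathZ2012, proof of Theorem (3) ("if ρ̄₈ is surjective, then so is ρ̄₄")] -/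
theorem hasSurjectiveModNGaloisRep_four_of_eight (h8 : W.HasSurjectiveModNGaloisRep 8) :
    W.HasSurjectiveModNGaloisRep 4 := by
  apply hasSurjectiveModNGaloisRep_four_of_matrix W e
  intro g hg
  exact (hasSurjectiveModNGaloisRep_iff_matrix W e).mp h8 g ⟨g.det, hg⟩

end Lift

/-! ### §2. The four witnesses, and the two explicit elements -/

variable [W.IsElliptic] (h2 : (2 : K) ≠ 0)

/-- An element of `K̄` fixed by `Γ_K` lies in `K` (`K` perfect, `K̄/K` Galois). [folklore] -/
private theorem exists_eq_algebraMap [PerfectField K] {x : AlgebraicClosure K}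
    (hx : ∀ σ : Field.absoluteGaloisGroup K, σ • x = x) : ∃ q : K, algebraMap K _ q = x := by
  haveI : IsGalois K (AlgebraicClosure K) := {}
  exact (InfiniteGalois.mem_range_algebraMap_iff_fixed x).mpr fun σ ↦ hx σ

/-- **`√2 ∉ K` ⟹ some `σ` moves `√2`**, i.e. `χ₂(det ρ̄₈σ) = -1`: the image is not inside
`ker (χ₂∘det)`. [cite: DokchitserDokchitserMathZ2012, proof of Theorem (3) (Im ρ̄₈ ↠ (ℤ/8ℤ)^×)] -/
theorem exists_c2_eq_one [PerfectField K] (hK : ¬ IsSquare (2 : K)) :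
    ∃ σ : Field.absoluteGaloisGroup K, c2 (M W h2 σ).det = 1 := by
  by_contra hno
  push Not at hno
  obtain ⟨q, hq⟩ := exists_eq_algebraMap (x := sqrtTwo W h2) fun σ ↦ by
    rw [smul_sqrtTwo, (by decide : ∀ z : ZMod 2, z ≠ 1 → z = 0) _ (hno σ), sgnUnit_zero]; simp
  refine hK ⟨q, (algebraMap K (AlgebraicClosure K)).injective ?_⟩
  rw [map_mul, hq, sqrtTwo_sq, map_ofNat]

/-- **`√-2 ∉ K` ⟹ some `σ` moves `√-2`** (`χ₋₂(det ρ̄₈σ) = -1`).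
[cite: DokchitserDokchitserMathZ2012, proof of Theorem (3) (Im ρ̄₈ ↠ (ℤ/8ℤ)^×)] -/
theorem exists_cm2_eq_one [PerfectField K] (hK : ¬ IsSquare (-2 : K)) :
    ∃ σ : Field.absoluteGaloisGroup K, c2 (M W h2 σ).det + cm1 (M W h2 σ).det = 1 := by
  by_contra hno
  push Not at hno
  obtain ⟨q, hq⟩ := exists_eq_algebraMap (x := sqrtNegTwo W h2) fun σ ↦ by
    rw [smul_sqrtNegTwo, (by decide : ∀ z : ZMod 2, z ≠ 1 → z = 0) _ (hno σ), sgnUnit_zero]; simp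
  refine hK ⟨q, (algebraMap K (AlgebraicClosure K)).injective ?_⟩
  rw [map_mul, hq, sqrtNegTwo_sq, map_neg, map_ofNat]

/-- **`2Δ ∉ K^{×2}` ⟹ some `σ` moves `√2·δ`** (`2Δ = 2·(4δ)²`), i.e. `χ₂(det)·sgn = -1` at `σ`:
the image is not inside `ker ((χ₂∘det)·sgn)`.
[cite: DokchitserDokchitserMathZ2012, proof of Theorem (3) (ℚ(√Δ,√-1,√2) is a C₂×C₂×C₂-extension)] -/
theorem exists_c2_add_sg_eq_one [PerfectField K] (hΔ : ¬ IsSquare (2 * W.Δ)) :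
    ∃ σ : Field.absoluteGaloisGroup K, c2 (M W h2 σ).det + sg (M W h2 σ) = 1 := by
  by_contra hno
  push Not at hno
  obtain ⟨q, hq⟩ := exists_eq_algebraMap (x := sqrtTwo W h2 * delta W h2) fun σ ↦ by
    rw [smul_mul', smul_sqrtTwo, smul_delta_eq, mul_mul_mul_comm, ← Int.cast_mul, ← sgnUnit_add,
      (by decide : ∀ z : ZMod 2, z ≠ 1 → z = 0) _ (hno σ), sgnUnit_zero]; simp
  refine hΔ ⟨4 * q, (algebraMap K (AlgebraicClosure K)).injective ?_⟩
  rw [map_mul, algebraMap_Δ W h2, map_mul, map_mul, map_ofNat, map_ofNat, hq]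
  have := sqrtTwo_sq W h2
  linear_combination (-(16 : AlgebraicClosure K) * delta W h2 ^ 2) * this

/-- **`-2Δ ∉ K^{×2}` ⟹ some `σ` moves `√-2·δ`** (`-2Δ = -2·(4δ)²`), i.e. `χ₋₂(det)·sgn = -1` at `σ`.
[cite: DokchitserDokchitserMathZ2012, proof of Theorem (3) (ℚ(√Δ,√-1,√2) is a C₂×C₂×C₂-extension)] -/
theorem exists_cm2_add_sg_eq_one [PerfectField K] (hΔ : ¬ IsSquare (-2 * W.Δ)) :
    ∃ σ : Field.absoluteGaloisGroup K, c2 (M W h2 σ).det + cm1 (M W h2 σ).det + sg (M W h2 σ) = 1 := by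
  by_contra hno
  push Not at hno
  obtain ⟨q, hq⟩ := exists_eq_algebraMap (x := sqrtNegTwo W h2 * delta W h2) fun σ ↦ by
    rw [smul_mul', smul_sqrtNegTwo, smul_delta_eq, mul_mul_mul_comm, ← Int.cast_mul, ← sgnUnit_add,
      (by decide : ∀ z : ZMod 2, z ≠ 1 → z = 0) _ (hno σ), sgnUnit_zero]; simp
  refine hΔ ⟨4 * q, (algebraMap K (AlgebraicClosure K)).injective ?_⟩
  rw [map_mul, algebraMap_Δ W h2, map_mul, map_mul, map_neg, map_ofNat, map_ofNat, hq]
  have := sqrtNegTwo_sq W h2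
  linear_combination (-(16 : AlgebraicClosure K) * delta W h2 ^ 2) * this

/-- `√2 ≠ 0`, `√-2 ≠ 0`, `δ ≠ 0`, `2 ≠ 0` in `K̄`. [folklore] -/
private theorem sqrt_ne_zero : sqrtTwo W h2 ≠ 0 ∧ sqrtNegTwo W h2 ≠ 0 ∧ (2 : AlgebraicClosure K) ≠ 0 := by
  have h2' : (2 : AlgebraicClosure K) ≠ 0 := fun h ↦ h2 (by
    have : algebraMap K (AlgebraicClosure K) 2 = 0 := by rw [map_ofNat, h]
    exact (map_eq_zero _).mp this)
  refine ⟨fun h ↦ h2' ?_, fun h ↦ h2' ?_, h2'⟩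
  · rw [← sqrtTwo_sq W h2, h, mul_zero]
  · have := sqrtNegTwo_sq W h2
    rw [h, mul_zero] at this
    linear_combination this

/-- No nonzero `x ∈ K̄` with `(4x)² ∈ K^{×2}` (image of a square of `K`) is sent to `-x` by some `σ`
(`4x = ±r` is fixed; `2 ≠ 0`). [folklore] -/
private theorem false_of_smul_eq_neg (h2' : (2 : AlgebraicClosure K) ≠ 0)
    (σ : Field.absoluteGaloisGroup K) {x : AlgebraicClosure K} (hx : x ≠ 0) (hmove : σ • x = -x)
    (r : K) (hsq : (4 * x) ^ 2 = (algebraMap K (AlgebraicClosure K) r) ^ 2) : False := by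
  have hfix : σ • (4 * x) = 4 * x := by
    rcases eq_or_eq_neg_of_sq_eq_sq _ _ hsq with h | h <;> rw [h]
    · exact (show AlgebraicClosure K ≃ₐ[K] AlgebraicClosure K from σ).commutes r
    · rw [smul_neg]
      exact congrArg Neg.neg ((show AlgebraicClosure K ≃ₐ[K] AlgebraicClosure K from σ).commutes r)
  rw [smul_mul', hmove, show σ • (4 : AlgebraicClosure K) = 4 from
    map_ofNat (show AlgebraicClosure K ≃ₐ[K] AlgebraicClosure K from σ) 4] at hfix
  have h8 : (2 * 2 * 2 : AlgebraicClosure K) * x = 0 := by linear_combination -hfix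
  exact mul_ne_zero (mul_ne_zero (mul_ne_zero h2' h2') h2') hx h8

/-- **`diag(1,3) ∈ Im ρ̄₈` ⟹ `2Δ ∉ K^{×2}`** ("as `ℚ(√Δ) ≠ ℚ(√2)`"): an element acting trivially on
`E[2]` (so fixing `δ`) with determinant `3` sends `√2δ ↦ -√2δ`, while `2Δ = r²` would make
`4√2δ = ±r ∈ K`. [cite: DokchitserDokchitserMathZ2012, proof of Theorem (3) ("as ℚ(√Δ) ≠ ℚ(√±2), Δ ∉ ±2ℚ^{×2}")] -/
theorem not_isSquare_two_mul_Δ (σ : Field.absoluteGaloisGroup K) (hσ : M W h2 σ = !![1, 0; 0, 3]) :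
    ¬ IsSquare (2 * W.Δ) := by
  rintro ⟨r, hr⟩
  obtain ⟨hs, -, h2'⟩ := sqrt_ne_zero W h2
  refine false_of_smul_eq_neg h2' σ (mul_ne_zero hs (delta_ne_zero W h2)) ?_ r ?_
  · rw [smul_mul', smul_sqrtTwo, smul_delta_eq, hσ, show c2 (!![1, 0; 0, 3] : M8).det = 1 by decide,
      show sg (!![1, 0; 0, 3] : M8) = 0 by decide]
    simp
  · rw [← map_pow, pow_two r, ← hr, map_mul, map_ofNat, algebraMap_Δ W h2]
    have := sqrtTwo_sq W h2
    linear_combination (16 * delta W h2 ^ 2) * this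

/-- **`diag(1,5) ∈ Im ρ̄₈` ⟹ `-2Δ ∉ K^{×2}`** ("as `ℚ(√Δ) ≠ ℚ(√-2)`").
[cite: DokchitserDokchitserMathZ2012, proof of Theorem (3) ("as ℚ(√Δ) ≠ ℚ(√±2), Δ ∉ ±2ℚ^{×2}")] -/
theorem not_isSquare_neg_two_mul_Δ (σ : Field.absoluteGaloisGroup K)
    (hσ : M W h2 σ = !![1, 0; 0, 5]) : ¬ IsSquare (-2 * W.Δ) := by
  rintro ⟨r, hr⟩
  obtain ⟨-, hs, h2'⟩ := sqrt_ne_zero W h2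
  refine false_of_smul_eq_neg h2' σ (mul_ne_zero hs (delta_ne_zero W h2)) ?_ r ?_
  · rw [smul_mul', smul_sqrtNegTwo, smul_delta_eq, hσ,
      show c2 (!![1, 0; 0, 5] : M8).det + cm1 (!![1, 0; 0, 5] : M8).det = 1 by decide,
      show sg (!![1, 0; 0, 5] : M8) = 0 by decide]
    simp
  · rw [← map_pow, pow_two r, ← hr, map_mul, map_neg, map_ofNat, algebraMap_Δ W h2]
    have := sqrtNegTwo_sq W h2
    linear_combination (16 * delta W h2 ^ 2) * this

/-! ### §3. Clause (3) over a perfect field with `2 ≠ 0`, `±2 ∉ K^{×2}`; and over `ℚ` -/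

include h2 in
/-- **Dokchitser–Dokchitser, Theorem (3), over a perfect field `K` with `2 ≠ 0` and `2, -2 ∉ K^{×2}`:**
`ρ̄_{E,8}` is onto `Aut(E[8])` iff `ρ̄_{E,4}` is onto `Aut(E[4])` and `2Δ, -2Δ ∉ K^{×2}`.
[cite: DokchitserDokchitserMathZ2012, Theorem (3) and its proof] -/
theorem hasSurjectiveModNGaloisRep_eight_iff_of_two_ne_zero [PerfectField K]
    (hK2 : ¬ IsSquare (2 : K)) (hKm2 : ¬ IsSquare (-2 : K)) :
    W.HasSurjectiveModNGaloisRep 8 ↔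
      W.HasSurjectiveModNGaloisRep 4 ∧ ¬ IsSquare (2 * W.Δ) ∧ ¬ IsSquare (-2 * W.Δ) := by
  have hmat := hasSurjectiveModNGaloisRep_iff_matrix W (frame8 W h2)
  constructor
  · intro h8
    have hM : ∀ g : M8, g.det * g.det = 1 → ∃ σ : Field.absoluteGaloisGroup K, M W h2 σ = g :=
      fun g hg ↦ hmat.mp h8 g ⟨g.det, hg⟩
    obtain ⟨σ₃, h₃⟩ := hM !![1, 0; 0, 3] (by decide)
    obtain ⟨σ₅, h₅⟩ := hM !![1, 0; 0, 5] (by decide)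
    exact ⟨hasSurjectiveModNGaloisRep_four_of_matrix W (frame8 W h2) hM,
      not_isSquare_two_mul_Δ W h2 σ₃ h₃, not_isSquare_neg_two_mul_Δ W h2 σ₅ h₅⟩
  · rintro ⟨h4, hΔ2, hΔm2⟩
    have honto := surjective_of_liftsModFour (rhoMat W (frame8 W h2))
      (exists_rhoMat_eq_add_four_mul_of_four W (frame8 W h2) h4) (exists_c2_eq_one W h2 hK2)
      (exists_cm2_eq_one W h2 hKm2) (exists_c2_add_sg_eq_one W h2 hΔ2)
      (exists_cm2_add_sg_eq_one W h2 hΔm2)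
    exact hmat.mpr fun g ⟨d', hd⟩ ↦ honto g (mul_self_of_mul_eq_one hd)

/-- `2 ∉ ℚ^{×2}` (irrationality of `√2`). [folklore] -/
private theorem not_isSquare_two_rat : ¬ IsSquare (2 : ℚ) := by
  rintro ⟨r, hr⟩
  have h : Real.sqrt 2 = |(r : ℝ)| := by
    rw [← Real.sqrt_sq_eq_abs, sq, ← Rat.cast_mul, ← hr, Rat.cast_ofNat]
  exact irrational_sqrt_two ⟨|r|, by rw [h, Rat.cast_abs]⟩

/-- `-2 ∉ ℚ^{×2}` (squares are nonnegative). [folklore] -/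
private theorem not_isSquare_neg_two_rat : ¬ IsSquare (-2 : ℚ) := by
  rintro ⟨r, hr⟩
  have := mul_self_nonneg r
  linarith

/-- **Dokchitser–Dokchitser 2012, Theorem (3): `ρ̄_{E,8}` is onto `Aut(E[8])` iff `ρ̄_{E,4}` is onto
`Aut(E[4])` and `Δ ∉ ±2·ℚ^{×2}`** (for an elliptic curve over `ℚ`, any Weierstrass model). This is
conjunct (3) of the named fact `DokchitserDokchitser2012_surjective_mod_two_four_eight`, with the
same spelling. [cite: DokchitserDokchitserMathZ2012, Theorem (3) (p. 961) and its proof] -/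
theorem hasSurjectiveModNGaloisRep_eight_iff (W : WeierstrassCurve ℚ) [W.IsElliptic] :
    W.HasSurjectiveModNGaloisRep 8 ↔
      W.HasSurjectiveModNGaloisRep 4 ∧ ¬ IsSquare (2 * W.Δ) ∧ ¬ IsSquare (-2 * W.Δ) := by
  haveI : PerfectField ℚ := PerfectField.ofCharZero
  exact hasSurjectiveModNGaloisRep_eight_iff_of_two_ne_zero W two_ne_zero not_isSquare_two_rat
    not_isSquare_neg_two_rat

end Literature.NumberTheory.EllipticCurves.DokchitserDokchitser2012

namespace Literature.NumberTheory.EllipticCurves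

/-- Clause (3) of `DokchitserDokchitser2012_surjective_mod_two_four_eight`, in the fact's own
quantifier shape (`∀ W [IsElliptic], …`). [cite: DokchitserDokchitserMathZ2012, Theorem (3)] -/
theorem DokchitserDokchitser2012_surjective_mod_eight_iff :
    ∀ (W : WeierstrassCurve ℚ) [W.IsElliptic],
      W.HasSurjectiveModNGaloisRep 8 ↔
        W.HasSurjectiveModNGaloisRep 4 ∧ ¬ IsSquare (2 * W.Δ) ∧ ¬ IsSquare (-2 * W.Δ) :=
  fun W _ ↦ DokchitserDokchitser2012.hasSurjectiveModNGaloisRep_eight_iff W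

/-- **The named fact reduced to its clause (2) alone.** Granted, for every elliptic `W/ℚ`, the printed
criterion for `ρ̄₄` (Dokchitser–Dokchitser, Theorem (2), copied verbatim from
`DokchitserDokchitser2012_surjective_mod_two_four_eight`; NOT proved here — the hypothesis `h`), the
whole fact follows, clauses (1) and (3) being the kernel theorems `hasSurjectiveModNGaloisRep_two_iff`
and `hasSurjectiveModNGaloisRep_eight_iff` (no new named fact). [cite: DokchitserDokchitserMathZ2012, Theorem (1)–(3)] -/
theorem DokchitserDokchitser2012_surjective_mod_two_four_eight_of_clause_two
    (h : ∀ (W : WeierstrassCurve ℚ) [W.IsElliptic],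
      W.HasSurjectiveModNGaloisRep 4 ↔
        W.HasSurjectiveModNGaloisRep 2 ∧ ¬ IsSquare (-W.Δ) ∧ ∀ t : ℚ, W.j ≠ -4 * t ^ 3 * (t + 8)) :
    DokchitserDokchitser2012_surjective_mod_two_four_eight :=
  fun W _ ↦ ⟨hasSurjectiveModNGaloisRep_two_iff W, h W,
    DokchitserDokchitser2012.hasSurjectiveModNGaloisRep_eight_iff W⟩

end Literature.NumberTheory.EllipticCurves

end
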